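import Summits.CriticalPhenomena.PercolationContinuityZ3.Theorems.PercNearOneGluingNoHeavyLowerTailSahiTransportJRRows
import Literature.Probability.LatticeModels.StrassenHolleyCoupling

/-!
# `NoHeavyLowerTail` (crux stmt-CriticalPhenomena-4575), Sahi / Kahn positivity: parameter-free transport certificates — SOUNDNESS (IV), the certificate

Support file (cell `prim-l12`, seat P3, gen 5; `--supports stmt-CriticalPhenomena-4575`).  No `sorry`, no named facts, standard axioms.
Part of the SOUNDNESS of the parameter-free transport-certificate check `SahiTransportJR.checkTab` (`…SahiTransportJRTables`): if the digit test of
every capacity row and every (TC) row of a coefficient table `ct` for the pattern event with bitmask `M` passes, then at EVERY parameter vector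
`q ∈ [0,1]^m` the scaled measure `σ_q(T) = (1/DEN)·Σ_{η ∉ H ∋ ζ} ct[η][ζ][code T]·w_q(η)w_q(ζ)` satisfies (o), (a), (TC) of the reduced certificate,
hence (Strassen) a `SahiTransportCert.TransportCert` exists and Kahn's Conjecture 5 / Sahi's `C₃` holds for that junta first slot with the other
two slots arbitrary (`…SahiTransportCert.sahiE_three_nonneg_of_transportCert`).  Chain: `…JRDict` (dictionary `Set (Fin m)` ↔ bitmasks for
general `m`, structural facts of a table) → `…JRMeasure` (the scaled measure: mass, support, the stochastic-order condition (o)) → `…JRRows`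
(capacity and (TC) rows: certificate numbers = `cubicZ` of explicit term families, digit test ⇒ row inequality) → `…JRSound` (the certificate and
`sahiE_three_nonneg_of_checkTab`). [this work]

This file: **`transportCert_of_checkTab`** — `checkTab σ m M ct = true` and "the low `2^m` bits of `M` describe `P`" give, for every
`q : Fin m → [0,1]`, a kernel `Kr` with `SahiTransportCert.TransportCert q P Kr` (Strassen coupling of `θ·w|_{Pᶜ}` with the scaled measure);
`transportCert_of_checkJR` (the join–reduce table); **`sahiE_three_nonneg_of_checkTab`** — Kahn's Conjecture 5 / Sahi's `C₃` for a block-determined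
first slot whose pattern event passes the check, the other two increasing events arbitrary, every dimension.  With the evaluations of the companion
files (`checkJR 28 3 M` for all `18` nontrivial events of `2^3`; `m = 4` per event) this is a second, uniform proof of the `|A| ≤ 3` theorem of
`…SahiJuntaSlotLeThree` and the route to `|A| = 4`.
-/

noncomputable section

open scoped Classical

namespace Summit.CriticalPhenomena.PercolationContinuityZ3.Theorems.SahiTransportJR

open Finset SahiHittingSlot SahiTransportCert SahiC3Cube SahiTransportCheck OneCutCert CovTransferCert Literature.Combinatorics.Sahi2008
open Literature.Probability.LatticeModels (exists_monotoneCoupling_of_upperSets_le)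
open Literature.Probability.Percolation (DeterminedBy)
open Literature.Probability.Percolation.BHK2006 (weight ind_inter)
open Literature.Probability.Percolation.DecisionTree (ind ind_of_mem ind_of_not_mem ind_nonneg)

variable {m : ℕ}

/-! #### The certificate -/

/-- Increasing events have bitmasks in `upsN`. [this work] -/
theorem encA_mem_upsN' {𝒳 : Set (Set (Fin m))} (h𝒳 : IsUpperSet 𝒳) : encA m 𝒳 ∈ upsN m := by
  unfold upsN
  rw [List.mem_filter, List.mem_range]
  exact ⟨encA_lt m 𝒳, isUpN_encA h𝒳⟩

/-- `w(Y ∩ 𝒯)` as a weighted indicator sum. [this work] -/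
theorem pr_inter_eq_sum' (q : Fin m → unitInterval) (Y 𝒯 : Set (Set (Fin m))) :
    pr q (Y ∩ 𝒯) = ∑ T, bernoulliWeight q T * ind Y T * ind 𝒯 T := by
  rw [pr_eq_sum]
  exact Finset.sum_congr rfl fun T _ => by rw [ind_inter, mul_assoc]

/-- A sum over a finset of patterns as an indicator sum. [this work] -/
theorem sum_mem_eq_sum_mul_ind' (U : Finset (Set (Fin m))) (f : Set (Fin m) → ℝ) :
    ∑ T ∈ U, f T = ∑ T, f T * ind (↑U : Set (Set (Fin m))) T := by
  rw [← Finset.sum_filter_add_sum_filter_not Finset.univ (fun T => T ∈ U)]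
  have h1 : (Finset.univ.filter fun T => T ∈ U) = U := by ext T; simp
  rw [h1, Finset.sum_eq_zero (s := Finset.univ.filter fun T => ¬ T ∈ U) (fun T hT => by
    rw [ind_of_not_mem (show T ∉ (↑U : Set (Set (Fin m))) from fun h => (Finset.mem_filter.1 hT).2 (Finset.mem_coe.1 h)), mul_zero]),
    add_zero]
  exact Finset.sum_congr rfl fun T hT => by rw [ind_of_mem (Finset.mem_coe.2 hT), mul_one]

/-- **SOUNDNESS OF THE TABLE CHECK.**  If `checkTab σ m M ct` passes and the low `2^m` bits of `M` describe the pattern event `P`, then at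
EVERY parameter vector the scaled measure of the table extends, by Strassen's theorem (`Literature…StrassenHolleyCoupling`), to a transport
certificate for `P` in the sense of `SahiTransportCert.TransportCert`. [this work] -/
theorem transportCert_of_checkTab {σ M : ℕ} {ct : Tab} (h : checkTab σ m M ct = true) {P : Set (Set (Fin m))}
    (hPM : ∀ x, x < 2 ^ m → (M.testBit x = true ↔ pt m x ∈ P)) (q : Fin m → unitInterval) : ∃ Kr, TransportCert q P Kr := by
  -- unpack the check
  unfold checkTab at h
  simp only [Bool.and_eq_true, decide_eq_true_eq, List.all_eq_true, Bool.or_eq_true] at h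
  obtain ⟨⟨⟨⟨hσ, hbnd⟩, hstruct⟩, hcap⟩, htc⟩ := h
  have hf := tabFacts_of_structTab hstruct
  set θ := pr q P with hθ
  have hθ0 : 0 ≤ θ := pr_nonneg q P
  have hθ1 : θ ≤ 1 := pr_le_one q P
  have hmem : ∀ S : Set (Fin m), S ∈ P ↔ M.testBit (code S) = true := fun S => by
    rw [hPM _ (code_lt S), pt_code]
  -- the scaled measure and its properties
  set ν : Set (Fin m) → ℝ := sg m M ct q with hν
  have hν0 : ∀ T, 0 ≤ ν T := sg_nonneg hf q
  have hνH : ∀ T, T ∉ P → ν T = 0 := fun T hT => sg_eq_zero hf q (by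
    cases hb : M.testBit (code T)
    · rfl
    · exact (hT ((hmem T).2 hb)).elim)
  have hcapT : ∀ T, ν T ≤ (2 - θ) * bernoulliWeight q T := by
    intro T
    by_cases hT : T ∈ P
    · exact capacity_of_rowOK hPM hf hσ hbnd q T (hcap (code T) (mem_pts.2 ⟨code_lt T, (hmem T).1 hT⟩))
    · rw [hνH T hT]; exact mul_nonneg (by linarith) (bw_nonneg q T)
  have htcT : ∀ 𝒳 𝒵 : Set (Set (Fin m)), IsUpperSet 𝒳 → IsUpperSet 𝒵 → ∑ T, ν T * ind (𝒳 ∩ 𝒵) T ≤ tcR q P 𝒳 𝒵 := by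
    intro 𝒳 𝒵 h𝒳 h𝒵
    have hXu := encA_mem_upsN' h𝒳
    have hZu := encA_mem_upsN' h𝒵
    rcases Nat.lt_or_ge (encA m 𝒵) (encA m 𝒳) with hlt | hle
    · rcases htc (encA m 𝒵) hZu (encA m 𝒳) hXu with hlt' | hok
      · exact absurd hlt' (not_lt.2 hlt.le)
      · rw [Set.inter_comm, tcR_comm]; exact tc_of_rowOK hPM hf hσ hbnd q 𝒵 𝒳 hok
    · rcases htc (encA m 𝒳) hXu (encA m 𝒵) hZu with hlt' | hok
      · exact absurd hlt' (not_lt.2 hle)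
      · exact tc_of_rowOK hPM hf hσ hbnd q 𝒳 𝒵 hok
  have hmassν : ∑ T, ν T = pr q Pᶜ * θ := sum_sg hPM hf q
  -- the source measure and Strassen's coupling
  set μ : Set (Fin m) → ℝ := fun S => θ * (bernoulliWeight q S * ind Pᶜ S) with hμ
  have hμ0 : ∀ S, 0 ≤ μ S := fun S => mul_nonneg hθ0 (mul_nonneg (bw_nonneg q S) (ind_nonneg _ _))
  have hmass : ∑ S, μ S = ∑ T, ν T := by
    rw [hmassν]
    simp only [hμ]
    rw [← Finset.mul_sum, mul_comm]
    rfl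
  have hdom : ∀ U : Finset (Set (Fin m)), IsUpperSet (U : Set (Set (Fin m))) → ∑ S ∈ U, μ S ≤ ∑ T ∈ U, ν T := by
    intro U hU
    rw [sum_mem_eq_sum_mul_ind' U μ, sum_mem_eq_sum_mul_ind' U ν]
    have e1 : ∑ S, μ S * ind (↑U : Set (Set (Fin m))) S = θ * pr q (Pᶜ ∩ ↑U) := by
      rw [pr_inter_eq_sum', Finset.mul_sum]
      exact Finset.sum_congr rfl fun S _ => by simp only [hμ]; ring
    rw [e1]
    exact stoch_of_tabFacts hPM hf q hU
  obtain ⟨π, hπ0, hsupp, hrow, hcol⟩ := exists_monotoneCoupling_of_upperSets_le μ ν hμ0 hν0 hmass hdom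
  refine ⟨π, hπ0, fun S T hne => hsupp S T hne, fun S T hne hS => hne ?_, fun S T hne => ?_, fun S hS => ?_, fun T => ?_,
    fun 𝒳 𝒵 h𝒳 h𝒵 => ?_⟩
  · have hr : ∑ T, π S T = 0 := by rw [hrow S]; simp only [hμ]; rw [ind_of_not_mem (Set.notMem_compl_iff.2 hS)]; ring
    exact (Finset.sum_eq_zero_iff_of_nonneg fun T _ => hπ0 S T).1 hr T (Finset.mem_univ T)
  · by_contra hT
    have hc : ∑ S, π S T = 0 := by rw [hcol T]; exact hνH T hT
    exact hne ((Finset.sum_eq_zero_iff_of_nonneg fun S _ => hπ0 S T).1 hc S (Finset.mem_univ S))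
  · rw [hrow S]; simp only [hμ]; rw [ind_of_mem (show S ∈ Pᶜ from hS), mul_one]
  · rw [hcol T]; exact hcapT T
  · calc ∑ S, ∑ T, π S T * ind (𝒳 ∩ 𝒵) T = ∑ T, (∑ S, π S T) * ind (𝒳 ∩ 𝒵) T := by
          rw [Finset.sum_comm]; simp [Finset.sum_mul]
      _ = ∑ T, ν T * ind (𝒳 ∩ 𝒵) T := Finset.sum_congr rfl fun T _ => by rw [hcol T]
      _ ≤ tcR q P 𝒳 𝒵 := htcT 𝒳 𝒵 h𝒳 h𝒵

/-- The check specialised to the join–reduce table. [this work] -/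
theorem transportCert_of_checkJR {σ M : ℕ} (h : checkJR σ m M = true) {P : Set (Set (Fin m))}
    (hPM : ∀ x, x < 2 ^ m → (M.testBit x = true ↔ pt m x ∈ P)) (q : Fin m → unitInterval) : ∃ Kr, TransportCert q P Kr := by
  unfold checkJR at h
  simp only [Bool.and_eq_true] at h
  exact transportCert_of_checkTab h.2 hPM q

/-- The bitmask of an event describes it. [this work] -/
theorem encA_spec (P : Set (Set (Fin m))) : ∀ x, x < 2 ^ m → ((encA m P).testBit x = true ↔ pt m x ∈ P) := by
  intro x hx; rw [testBit_encA]; simp [hx]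

/-- **Kahn's Conjecture 5 / Sahi's `C₃` for a certified junta slot**, from the table check at the pattern event: `E₃(1_H, 1_U, 1_V) ≥ 0` for
all increasing `U, V` in every dimension, whenever `checkTab σ k (encA k (pat e H)) ct` passes for the block `e : Fin k ↪ ι` determining `H`. [this work] -/
theorem sahiE_three_nonneg_of_checkTab {ι : Type} [Fintype ι] {k σ : ℕ} {ct : Tab} (p : ι → unitInterval) (e : Fin k ↪ ι)
    {H : Set (Set ι)} (hH : DeterminedBy H (Set.range e)) (h : checkTab σ k (encA k (pat e H)) ct = true)
    {U V : Set (Set ι)} (hU : IsUpperSet U) (hV : IsUpperSet V) :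
    0 ≤ sahiE (bernoulliWeight p) 3 ![ind H, ind U, ind V] := by
  obtain ⟨Kr, hKr⟩ := transportCert_of_checkTab h (encA_spec (pat e H)) (pk e p)
  exact sahiE_three_nonneg_of_transportCert p e hH hKr hU hV

end Summit.CriticalPhenomena.PercolationContinuityZ3.Theorems.SahiTransportJR
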